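import Literature.MathematicalPhysics.QuantumFieldTheory.Balaban1983to89.B9Eq3105FamThreeCover
import Literature.MathematicalPhysics.QuantumFieldTheory.Balaban1983to89.B9ThmDCubePlateau

/-!
# `Balaban1983to89.B9Eq3105FamThreeCore` — FAMILY 3 OF (3.105) AT THE LETTERS, THE MEMBER-LETTER WORDS: the located difference
# `ζ_□̃·(DPD*(U₁) − DP_□D*(V′))·h_□` re-telescoped as `D·[Δ·S·G′ + G′·S·Δ − Δ·S·Δ + G′_□·Σ·G′_□]·D*` (`Δ = G′(U₁) − G′_□(V′)`,
# `Σ = S(U₁) − S_□(V′)`); the plateau cut-off `χ_□` inserted exactly next to each `Δ` (`ζ_□̃·D = ζ_□̃·D·χ_□`, `D*·h_□ = χ_□·D*·h_□`); and the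
# three MEMBER words estimated on the member's bond carrier by r06's typed engine `hasMajorantHom_word349₂` from the (3.42) blocks of `G′(U₁)`, the
# block-locality of `Q′, Q′*`, a (3.48) block of `X⁻¹(U₁)` and the DISPLAYED located `G′`-difference entries — so that F3-C's binder `hX` is supplied
# modulo those entries and the ONE remaining cube-letter word `G′_□·Σ·G′_□` (sub-row G-B9-LETTERS, GAPS G-B9-05∕family 3, programme FAMTHREE FILE F3-B;
# lead g34 RULING FAMTHREE-2 2026-08-29 00:30Z adopting amendments (A1)∕(A2); memo `lit-balaban-p33/g102/FAMTHREE-SCOPE.md` v2)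

statement-level skeleton of published theorems with citation tags; proofs where landed; nothing here is a claim about the Yang–Mills mass gap

THE PRINTED LOCUS (verbatim, held `paper:balaban1985-cmp99-background-propagators`, journal page = PDF page + 388).  p. 414 (3.105), third sum:
«− Σ_□ ζ_□̃(DPD* − DP_□D*)h_□G_□h_□»; p. 415 l.18–37 (text layer p0027, glyphs confirmed by the [B9] page owner r06 against the render): «Now let us take the
expansions (3.90), (3.98) constructed for the partition 𝒟′, and let us insert them in the place of the operator P in terms of (3.105) determined by the fixed □.
… The expansion of the term in the third sum gives also small terms, except the following one: ζ_□̃Dh′_{□₀}G′_{□₀}h′_{□₀}Q′*h′_{□₀}C_{□₀}h′_{□₀}Q′h′_{□₀}G′_{□₀}h′_{□₀}D*h_□G_□h_□.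
… Next we replace the operators G′_{□₀} and C_{□₀} by G′_□, C_□, terms with the differences G′_{□₀} − G′_□ and C_{□₀} − C_□ are small by the same reason as
before. … we get the following expression without small factors ζ_□̃DG′_□Q′*C_□Q′G′_□D*h_□G_□h_□ = ζ_□̃DP_□D*h_□G_□h_□. This expression cancels the second term
in the third sum.»; p. 412 l.22–36 («if we have a difference of propagators defined on two domains, then in an estimate of this difference we have, besides the
usual factors …, an exponential factor with a distance between localizations and a closest point where a change was made … proved in [2]»); p. 399 l.19–24
(«Such results were proved in [2] for scalar field propagators, see (1.11), (1.12)»); (3.25) p. 394; (3.49) p. 399; Thm 3.1 (3.42) p. 397; Thm 3.2 (3.48) p. 398;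
(3.21), (3.24) p. 394; (3.3) pp. 390–391, (3.8) p. 392; Cor. 3.6 p. 408; [4] (2.51)–(2.55) p. 232, Lemma 2.1 (2.60)–(2.61) p. 234; [2] = `Balaban1983RegularityDecay`
(CMP 89 (1983) 571–597), (1.11)–(1.12).

OURS, NOT PRINT's (lead g34 RULING FAMTHREE-2, condition): the re-telescoping `ASA − BS_□B = Δ·S·A + A·S·Δ − Δ·S·Δ + B·Σ·B` of §1 and the located estimate of its
first three words are a KERNEL-LEVEL DEVICE OF OURS for the (R)-design letters; print's p. 415 argument is a random-walk expansion of `P` ((3.90), (3.98) for the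
partition 𝒟′) followed by the cancellation «ζ_□̃DG′_□Q′*C_□Q′G′_□D*h_□G_□h_□ = ζ_□̃DP_□D*h_□G_□h_□. This expression cancels the second term in the third sum.» —
quoted here, NOT reproduced.  The located `G′`-difference entries (memo §3 D1) carry print's «terms with the differences G′_{□₀} − G′_□ … are small by the same
reason as before» as DISPLAYED hypotheses with an explicit constant `ε_D ≥ 0` (supplier NONE, GAPS G-B9-05).

WHY THIS FILE.  F3-C (`B9Eq3105FamThreeCover.hasMajorant_sum_famThree_zetaY_of_eBlock`) reduced the consumer's `hrest` family-3 summand to ONE per-cube binder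
`hX □ : conj b((M_{ζ_□}·(DPDsY − Pl □)·M_{h_□})^ℝ) ≺ K_X·ℓ(a)⁻²·e^{−a_Xδ·d}`.  F3-A (`B9Eq3105FamThreeLetters`) wrote `M_ζ·(DPDsY U − DPDsCubeY □ V′)·M_h` as
`M_ζ·D_U·[…]·D*_U·M_h` under the (3.35) window.  THIS FILE supplies the member-letter part of `hX`: with the symmetric re-telescoping (A1) the words `Δ·S·A`,
`A·S·Δ`, `Δ·S·Δ` (`A = G′(U)`, `S = Q′*X⁻¹Q′(U)`) contain NO cube letter except inside `Δ`, whose rows (resp. columns) are cut to the plateau `χ_□` by the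
outer `ζ_□̃·D` (resp. `D*·h_□`) EXACTLY (A2) — so each is ONE call of r06's `hasMajorantHom_word349₂` on `geo9K` with the displayed entries of `M_χ·Δ` ∕ `Δ·M_χ`
in the end-letter slots (Z2-P's road: `B9Ineq349DPDsYOfEBlock` §2), and the located sum is bounded by `ε·ℓ(a)⁻²·e^{−ρd}` with `ε` linear in `ε_D`.

WHAT THIS FILE CERTIFIES (kernel-checked; 0 `def`, 0 `def … : Prop`, 0 sorry; standard axioms only)

* §1 ★ `comp3_sub_comp3'` (`ASA′ − BS′B′ = (A−B)SA′ + AS(A′−B′) − (A−B)S(A′−B′) + B(S−S′)B′`), ★★ `famThree_word_eq'` (F3-A's identity in the (A1) form),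
  `pHatWordY_eq_conj₂`, `word_eq_conj₂` (the η-weighted conjugated word with TWO end letters IS `conj b` of the letter word), `located_words_eq` (the plateau
  insertions distribute to the three words as `(M_χΔ)SA + AS(ΔM_χ) − (M_χΔ)S(ΔM_χ)`).
* §2 ★ `cutMulY_comp_gradY_eq_of_plateau` (`M_f·D_U = M_f·D_U·M_χ` when `χ = 1` on the gradient stencil of `supp f`), ★ `divY_comp_cutMulY_eq_of_plateau`
  (`D*_U·M_f = M_χ·D*_U·M_f` likewise), and the record's instances ★ `chiY_eq_one_of_zetaY_gradK` (`ζ_□̃ = zetaY`: `□̃ ⊂ NearC 2S_j`, one step, `χ_□ = 1` on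
  `NearC 3S_j`), ★ `chiY_eq_one_of_hTY_gradK` (`h_□`: `supp h_□ ⊂ NearC S_j`).
* §3 ★★★ `hasMajorant_conj_gradWdiv_of_entries` — the member (3.49)₄ FOR TWO END LETTERS GIVEN BY ENTRIES: `conj b((D_U·E_L·S(U)·E_R·D*_U)^ℝ) ≺
  κ·ℓ(a)⁻²·e^{−ρd}` over `(toB6 (geo9K i) Rr Hp, ιB∘blkV1)` from `∀ μ, conj b(∇_μ)·conj b(η²E_L) ≺ B_L·ℓ(a)·e^{−δd}`, `∀ ν, conj b(η²E_R)·conj b(∇*_ν) ≺ B_R·ℓ(a)·e^{−δd}`,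
  bi-contractive `parS U`, `η = |c_f|⁻¹`, `conj b(s·X⁻¹(U)) ≺ B₁ℓ⁻⁴e^{−δd}` (`η⁴s = 1`), (2.61), the transfers of `ℓ, ℓ⁻⁴`; `κ = (M₂Σ‖b_j‖)²B_LB₁((d+1)B_R)Λ⁴c₁²`.
* (the sequel `B9Eq3105FamThreeMember` instantiates §3 three times at the consumer's letters with the DISPLAYED located `G′`-difference entries, puts the
  outer cut-offs back by §1–§2, and delivers F3-C's binder shape modulo the `C`-difference word.)

HONEST SCOPE ∕ NOT CLAIMED.  (i) §3's end-letter entries `hL`, `hR`, the (3.48) block `hCinv`, bi-contractive `parS`, `η = |c_f|⁻¹`, the member (2.61) and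
the transfers are HYPOTHESES here (as in Z2-P); the sequel feeds `hL`∕`hR` with the (3.42) entries of `G′(U₁)` and with the DISPLAYED located `G′`-difference
entries (GAPS G-B9-05 `hD` species, supplier NONE; print: O(e^{−2δ₀M}) by [2], p. 412 l.22–36, p. 399 l.19–24).  (ii) §1–§2 are exact algebra ∕ geometry; no
estimate of the `C`-difference word `BΣB` (file F3-B3).  (iii) Nothing of Thm 3.1 ∕ 3.2 ∕ 3.9 is re-proved.  Count-neutral; NOT a node
discharge; no summit ∕ sub-problem statement is proved; nothing continuum ∕ OS ∕ mass-gap ∕ Clay; YM mass gap NOT proved (Track A conditional rung).  No `sorry`,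
no `axiom`, no `… : Prop` fact, no `instance`, no `notation`, no `def`.  NEW file; nothing landed is modified.  Cell `lit-balaban`, seat `lit-balaban-p33` gen 103,
2026-08-29; `--supports stmt-QuantumFields-19200` as helper.  Net new unproved facts: 0.

RELATED IN THE TREE, NOT DUPLICATED (searched 2026-08-29: `rg 'gradWdiv_of_entries|memberWords|of_plateau' Literature/` = ∅): p33 Z2-P `B9Ineq349DPDsYOfEBlock` (§2's
pattern; `pHatWordY_eq_conj`, `inv_etaS_coe_eq` USED BY NAME), F3-A `B9Eq3105FamThreeLetters` (`famThree_word_eq`), F3-C `B9Eq3105FamThreeCover`, r06 `B9Ineq349Hom`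
(`hasMajorantHom_word349₂`), `B9Eq376DerivDict`, p21 `B9Thm39CinvSandwichQ`, `B9CubeLettersInvReadDict`, p38 `B9Cor36DPDsCubeAtLocCfg.hasMajorant_conj_gradMdiv_of_relabel`,
p21 `B9ThmDCubePlateau.nearC_of_mem_QbigT`, p33 `B9Cor36CubeCutoffs` (`chiY`, `NearC`), `B9Eq3104CutoffCommutatorSizes.gradK_ne_zero_imp` — all USED BY NAME.
-/

noncomputable section

namespace Literature.MathematicalPhysics.QuantumFieldTheory.Balaban1983to89.B9Eq3105FamThreeCore

open NormedSpace Complex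
open B6RandomWalk (HasMajorant hasMajorant_mono hasMajorant_add Ineq261 c1_nonneg Triangle254)
open B9FromB6 (EBlock)
open B6RandomWalkHom (HasMajorantHom hasMajorantHom_mono hasMajorantHom_iff)
open B9Thm34Ext (toB6)
open B9Thm37Sum (mulOp mulOp_apply)
open B9Ineq347 (ScaleTransfer)
open B9Eq352DivFormLetters (conj)
open B9Eq352GradLetters (diffLetter)
open B9Eq376POneLetters (conjHom gradLin divLin conjHom_eq_conj conjHom_comp)
open B9Eq376DerivDict (hasMajorantHom_gradLin hasMajorantHom_divLin)
open B9Ineq349Hom (hasMajorantHom_word349₂)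
open B9Ineq368PPrime (hasMajorant_sub)
open B6KLevelCensusIndexV1 (KIdx)
open B6Cover236MultiLevelBlocks (cubes)
open B6GlobalChartV1 (blkV1)
open B6Geom246MultiLevelBox (blkOf)
open B6Ineq2142KLevelV1 (β)
open B6Partition118KLevelTorusCentral (QbigT)
open B9GeoNormsKLevelV1 (geo9K)
open B9GeoLemma21KLevelV1 (one_le_Mh)
open B9CubeLettersInvReadDict (hasMajorant_gradF_mul_G_of_eBlockInv hasMajorant_G_mul_gradB_of_eBlockInv)
open B9Thm39CinvSandwichQ (hasMajorantHom_conjHom_QpY hasMajorantHom_conjHom_QpsY)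
open B9Cor35CinvAtCubeLetters (kernel_rate_mono)
open B9Cor36DPDsCubeAtLocCfg (hasMajorant_conj_gradMdiv_of_relabel)
open B9Thm37CubeCoverCommutators (cutMulY cutMulY_apply hTY)
open B9Thm37CubeCoverCommutatorSizes (four_le_P')
open B9Thm39CinvTorusRegular (conj_cutMulY)
open B9Eq395Small (hasMajorant_mulOp_left hasMajorant_mul_mulOp_right)
open B9Eq3104CutoffCommutators (hBdY hBdY_apply DPDsY)
open B9Eq3104CutoffCommutatorSizes (gradK_ne_zero_imp chart_tgt_eq_shiftY)
open B9Eq3105AtLetters (DPDsCubeY)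
open B9Eq3105ZetaY (zetaY mem_of_zetaY_ne_zero abs_hBdY_zetaY_le_one)
open B9Eq3105FamTwoCore (geo9K_axioms)
open B9Eq3105FamThreeLetters (famThree_word_eq)
open B9Ineq349DPDsYOfEBlock (pHatWordY_eq_conj inv_etaS_coe_eq)
open B9CubeLettersOpsL0 (GpCubeY)
open B9CubeLettersBondOpsL0 (QpCubeY QpsCubeY XinvCubeY)
open B9CubeLettersInvReadings (kernelFamilySInv)
open B9Cor36CubeCutoffs (SC NearC chiY chiY_eq_one_of_nearC one_le_SC nearC_shiftY nearC_of_hT_ne_zero)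
open B9ThmDCubePlateau (nearC_of_mem_QbigT)
open Node00 (SiteY BlkY IBondY FBondY CfgY SiteOpY SiteParY toKT etaS shiftY UboxY QpY QpsY XinvY gradY divY gradK divK)
open Node00.OpsYDeltaALocalAgree (gradY_apply_congr divY_apply_congr)
open Node00.OpsYNablaBridge (chartY divK_apply)

variable {d ℓ : ℕ} {hd : 1 ≤ d + 1} {hL : Odd (ℓ + 1) ∧ 1 < ℓ + 1} {b₀ b₁ : ℝ}
variable {𝔸 : Type} [NormedRing 𝔸] [NormedAlgebra ℂ 𝔸] [CompleteSpace 𝔸]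
variable {ι : Type} [Fintype ι]
variable (i : KIdx d ℓ hd hL b₀ b₁) (c : ↥(cubes i.D.toDomains)) (b : Module.Basis ι ℝ 𝔸)

/-! ## §1  Algebra: the symmetric re-telescoping (A1), the conjugated two-ended word, the distribution of the plateau insertions -/

section Algebra

omit [CompleteSpace 𝔸] in
/-- ★ **THE SYMMETRIC RE-TELESCOPING (A1)**: `A·S·A′ − B·S′·B′ = (A − B)·S·A′ + A·S·(A′ − B′) − (A − B)·S·(A′ − B′) + B·(S − S′)·B′` — the first three words
carry NO `B, B′` outside the differences (ours; lead g34 RULING FAMTHREE-2). [cite: Balaban1985BackgroundPropagators, p.415 l.19–22 (replace the letters), bookkeeping] -/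
theorem comp3_sub_comp3' {M N : Type} [AddCommGroup M] [Module ℂ M] [AddCommGroup N] [Module ℂ N]
    (A B : M →ₗ[ℂ] M) (S S' : M →ₗ[ℂ] M) (A' B' : N →ₗ[ℂ] M) :
    A ∘ₗ S ∘ₗ A' - B ∘ₗ S' ∘ₗ B' =
      (A - B) ∘ₗ S ∘ₗ A' + A ∘ₗ S ∘ₗ (A' - B') - (A - B) ∘ₗ S ∘ₗ (A' - B') + B ∘ₗ (S - S') ∘ₗ B' := by
  simp only [LinearMap.sub_comp, LinearMap.comp_sub]
  abel

variable (parS : SiteParY 𝔸 i)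

/-- ★★ **THE FAMILY-3 WORD AT THE LETTERS, (A1) FORM**: under F3-A's window hypotheses,
`M_ζ·(DPDsY parS G′ U − DPDsCubeY □ parS V′)·M_h = M_ζ·D_U·[Δ·S·A + A·S·Δ − Δ·S·Δ + B·(S − S_□)·B]·D*_U·M_h`, `A = G′(U)`, `B = G′_□(V′)`, `Δ = A − B`,
`S = Q′*X⁻¹Q′(U)`, `S_□ = Q′*_□X_□⁻¹Q′_□(V′)` (F3-A `famThree_word_eq` + `B·S·Δ = A·S·Δ − Δ·S·Δ`).
[cite: Balaban1985BackgroundPropagators, (3.105) p.414, p.415 l.19–24, (3.25) p.394, (3.3) pp.390–391, (3.8) p.392, Cor. 3.6 p.408] -/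
theorem famThree_word_eq' (Gp : SiteOpY 𝔸 i) (U V' : CfgY 𝔸 i) (ζb hb : FBondY i → ℝ)
    (hζ : ∀ b : FBondY i, ζb b ≠ 0 → V' b.dir b.src = U b.dir b.src) (hh : ∀ b : FBondY i, hb b ≠ 0 → V' b.dir b.src = U b.dir b.src) :
    cutMulY (𝔸 := 𝔸) ζb ∘ₗ (DPDsY i parS Gp U - DPDsCubeY i c parS V') ∘ₗ cutMulY (𝔸 := 𝔸) hb =
      cutMulY (𝔸 := 𝔸) ζb ∘ₗ (gradY i U ∘ₗ
        ((Gp U - GpCubeY i c parS V') ∘ₗ (QpsY i parS U ∘ₗ XinvY i parS Gp U ∘ₗ QpY i parS U) ∘ₗ Gp U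
          + Gp U ∘ₗ (QpsY i parS U ∘ₗ XinvY i parS Gp U ∘ₗ QpY i parS U) ∘ₗ (Gp U - GpCubeY i c parS V')
          - (Gp U - GpCubeY i c parS V') ∘ₗ (QpsY i parS U ∘ₗ XinvY i parS Gp U ∘ₗ QpY i parS U) ∘ₗ (Gp U - GpCubeY i c parS V')
          + GpCubeY i c parS V' ∘ₗ ((QpsY i parS U ∘ₗ XinvY i parS Gp U ∘ₗ QpY i parS U)
              - (QpsCubeY i c parS V' ∘ₗ XinvCubeY i c parS V' ∘ₗ QpCubeY i c parS V')) ∘ₗ GpCubeY i c parS V')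
        ∘ₗ divY i U) ∘ₗ cutMulY (𝔸 := 𝔸) hb := by
  rw [famThree_word_eq i c parS Gp U V' ζb hb hζ hh]
  congr 3
  simp only [LinearMap.sub_comp, LinearMap.comp_sub]
  abel

/-- ★ **THE η-WEIGHTED CONJUGATED WORD WITH TWO END LETTERS IS `conj b` OF THE LETTER WORD**:
`conj b(η²E_L)∘conĵQ′*∘conj b(s·C)∘conĵQ′∘conj b(η²E_R) = conj b((E_L·Q′*·C·Q′·E_R)^ℝ)` when `η²·η²·s = 1` (Z2-P's `pHatWordY_eq_conj` with `E_L ≠ E_R`).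
[cite: Balaban1985BackgroundPropagators, (3.25) p.394; Balaban1984PropagatorsII, (2.52)–(2.55) p.232] -/
theorem pHatWordY_eq_conj₂ (U : CfgY 𝔸 i) (EL ER : (SiteY i → 𝔸) →ₗ[ℂ] (SiteY i → 𝔸)) (C : (BlkY i → 𝔸) →ₗ[ℂ] (BlkY i → 𝔸))
    {η s : ℝ} (hs : (η ^ 2 * η ^ 2) * s = 1) :
    conj b ((η ^ 2) • EL.restrictScalars ℝ) ∘ₗ conjHom b ((QpsY i parS U).restrictScalars ℝ) ∘ₗ
        conj b (s • C.restrictScalars ℝ) ∘ₗ conjHom b ((QpY i parS U).restrictScalars ℝ) ∘ₗ conj b ((η ^ 2) • ER.restrictScalars ℝ) =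
      conj b ((EL ∘ₗ (QpsY i parS U ∘ₗ C ∘ₗ QpY i parS U) ∘ₗ ER).restrictScalars ℝ) := by
  have h1 : η ^ 2 * (s * η ^ 2) = 1 := by rw [← hs]; ring
  rw [← conjHom_eq_conj, ← conjHom_eq_conj, ← conjHom_eq_conj, ← conjHom_eq_conj, conjHom_comp, conjHom_comp, conjHom_comp, conjHom_comp]
  congr 1
  refine LinearMap.ext fun Φ => ?_
  simp only [LinearMap.comp_apply, LinearMap.smul_apply, LinearMap.restrictScalars_apply, LinearMap.map_smul_of_tower, smul_smul]
  rw [h1, one_smul]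

/-- the same between two arbitrary outer maps (the dressings `D`, `D*`), in the association r06's `hasMajorantHom_word349₂` returns.
[cite: Balaban1985BackgroundPropagators, (3.25) p.394, (3.49) p.399; Balaban1984PropagatorsII, (2.52) p.232, bookkeeping] -/
theorem word_eq_conj₂ {N P : Type} [AddCommGroup N] [Module ℝ N] [AddCommGroup P] [Module ℝ P]
    (F : ((SiteY i × ι) → ℝ) →ₗ[ℝ] N) (G : P →ₗ[ℝ] ((SiteY i × ι) → ℝ))
    (U : CfgY 𝔸 i) (EL ER : (SiteY i → 𝔸) →ₗ[ℂ] (SiteY i → 𝔸)) (C : (BlkY i → 𝔸) →ₗ[ℂ] (BlkY i → 𝔸))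
    {η s : ℝ} (hs : (η ^ 2 * η ^ 2) * s = 1) :
    (F ∘ₗ conj b ((η ^ 2) • EL.restrictScalars ℝ)) ∘ₗ conjHom b ((QpsY i parS U).restrictScalars ℝ) ∘ₗ
        conj b (s • C.restrictScalars ℝ) ∘ₗ conjHom b ((QpY i parS U).restrictScalars ℝ) ∘ₗ (conj b ((η ^ 2) • ER.restrictScalars ℝ) ∘ₗ G) =
      F ∘ₗ conj b ((EL ∘ₗ (QpsY i parS U ∘ₗ C ∘ₗ QpY i parS U) ∘ₗ ER).restrictScalars ℝ) ∘ₗ G := by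
  rw [← pHatWordY_eq_conj₂ i b parS U EL ER C hs]
  simp only [LinearMap.comp_assoc]

omit [CompleteSpace 𝔸] in
/-- ★ **THE PLATEAU INSERTIONS DISTRIBUTE**: if `M_ζ·D = M_ζ·D·M_χ` and `D*·M_h = M_χ·D*·M_h` then
`M_ζ·D·[ΔSA + ASΔ′ − ΔSΔ′]·D*·M_h = M_ζ·D·[(M_χΔ)SA + AS(Δ′M_χ) − (M_χΔ)S(Δ′M_χ)]·D*·M_h` — each difference gets the cut-off on the side it is probed from.
[cite: Balaban1985BackgroundPropagators, (3.105) p.414, p.415 l.19–24, bookkeeping] -/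
theorem located_words_eq {V W : Type} [AddCommGroup V] [Module ℂ V] [AddCommGroup W] [Module ℂ W]
    (Mz Mh : W →ₗ[ℂ] W) (D : V →ₗ[ℂ] W) (Ds : W →ₗ[ℂ] V) (Mx Δ Δ' S A : V →ₗ[ℂ] V)
    (hzg : Mz ∘ₗ D = Mz ∘ₗ D ∘ₗ Mx) (hdh : Ds ∘ₗ Mh = Mx ∘ₗ Ds ∘ₗ Mh) :
    Mz ∘ₗ (D ∘ₗ (Δ ∘ₗ S ∘ₗ A + A ∘ₗ S ∘ₗ Δ' - Δ ∘ₗ S ∘ₗ Δ') ∘ₗ Ds) ∘ₗ Mh =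
      Mz ∘ₗ (D ∘ₗ ((Mx ∘ₗ Δ) ∘ₗ S ∘ₗ A + A ∘ₗ S ∘ₗ (Δ' ∘ₗ Mx) - (Mx ∘ₗ Δ) ∘ₗ S ∘ₗ (Δ' ∘ₗ Mx)) ∘ₗ Ds) ∘ₗ Mh := by
  have hzg' : ∀ X : W →ₗ[ℂ] V, Mz ∘ₗ (D ∘ₗ X) = Mz ∘ₗ (D ∘ₗ (Mx ∘ₗ X)) := fun X => by
    rw [← LinearMap.comp_assoc, hzg, LinearMap.comp_assoc, LinearMap.comp_assoc]
  have e1 : Mz ∘ₗ (D ∘ₗ (Δ ∘ₗ S ∘ₗ A) ∘ₗ Ds) ∘ₗ Mh = Mz ∘ₗ (D ∘ₗ ((Mx ∘ₗ Δ) ∘ₗ S ∘ₗ A) ∘ₗ Ds) ∘ₗ Mh := by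
    simp only [LinearMap.comp_assoc]
    exact hzg' _
  have e2 : Mz ∘ₗ (D ∘ₗ (A ∘ₗ S ∘ₗ Δ') ∘ₗ Ds) ∘ₗ Mh = Mz ∘ₗ (D ∘ₗ (A ∘ₗ S ∘ₗ (Δ' ∘ₗ Mx)) ∘ₗ Ds) ∘ₗ Mh := by
    simp only [LinearMap.comp_assoc]
    conv_lhs => rw [hdh]
  have e3 : Mz ∘ₗ (D ∘ₗ (Δ ∘ₗ S ∘ₗ Δ') ∘ₗ Ds) ∘ₗ Mh = Mz ∘ₗ (D ∘ₗ ((Mx ∘ₗ Δ) ∘ₗ S ∘ₗ (Δ' ∘ₗ Mx)) ∘ₗ Ds) ∘ₗ Mh := by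
    simp only [LinearMap.comp_assoc]
    conv_lhs => rw [hdh]
    exact hzg' _
  simp only [LinearMap.add_comp, LinearMap.comp_add, LinearMap.sub_comp, LinearMap.comp_sub]
  rw [e1, e2, e3]

end Algebra

/-! ## §2  Geometry: the plateau cut-off `χ_□` next to the derivative letters -/

section Plateau

/-- ★ `M_f·D_U = M_f·D_U·M_χ` when `χ = 1` on the gradient stencil of every bond in `supp f` ((3.3): `(D_Uλ)(b)` reads `λ` on the stencil of `b` only).
[cite: Balaban1985BackgroundPropagators, (3.3) pp.390–391, (3.105) p.414 (ζ_□̃ = 1 near □)] -/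
theorem cutMulY_comp_gradY_eq_of_plateau (f : FBondY i → ℝ) (χ : SiteY i → ℝ) (U : CfgY 𝔸 i)
    (h : ∀ (b : FBondY i) (z : SiteY i), f b ≠ 0 → gradK i b z ≠ 0 → χ z = 1) :
    cutMulY (𝔸 := 𝔸) f ∘ₗ gradY i U = cutMulY (𝔸 := 𝔸) f ∘ₗ gradY i U ∘ₗ cutMulY (𝔸 := 𝔸) χ := by
  refine LinearMap.ext fun Λ => funext fun bnd => ?_
  simp only [LinearMap.comp_apply, cutMulY_apply]
  by_cases hf : f bnd = 0
  · rw [hf, Complex.ofReal_zero, zero_smul, zero_smul]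
  · congr 1
    exact gradY_apply_congr rfl fun z hz => by rw [cutMulY_apply, h bnd z hf hz, Complex.ofReal_one, one_smul]

/-- ★ `D*_U·M_f = M_χ·D*_U·M_f` when `χ = 1` on the gradient stencil of every bond in `supp f` ((3.8): `(D*_UA)(z)` sums over the bonds whose stencil holds `z`).
[cite: Balaban1985BackgroundPropagators, (3.8) p.392, (3.105) p.414] -/
theorem divY_comp_cutMulY_eq_of_plateau (f : FBondY i → ℝ) (χ : SiteY i → ℝ) (U : CfgY 𝔸 i)
    (h : ∀ (b : FBondY i) (z : SiteY i), f b ≠ 0 → gradK i b z ≠ 0 → χ z = 1) :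
    divY i U ∘ₗ cutMulY (𝔸 := 𝔸) f = cutMulY (𝔸 := 𝔸) χ ∘ₗ divY i U ∘ₗ cutMulY (𝔸 := 𝔸) f := by
  refine LinearMap.ext fun Λ => funext fun z => ?_
  simp only [LinearMap.comp_apply, cutMulY_apply]
  by_cases hχ : χ z = 1
  · rw [hχ, Complex.ofReal_one, one_smul]
  · -- no bond of `supp f` has `z` on its stencil: the row vanishes
    have h0 : divY i U (cutMulY (𝔸 := 𝔸) f Λ) z = divY i U 0 z := by
      refine divY_apply_congr fun bnd hb => ⟨?_, fun hne => rfl⟩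
      rw [divK_apply] at hb
      by_cases hfb : f bnd = 0
      · rw [cutMulY_apply, hfb, Complex.ofReal_zero, zero_smul, Pi.zero_apply]
      · exact absurd (h bnd z hfb hb) hχ
    rw [h0, map_zero, Pi.zero_apply, smul_zero]

/-- ★ **THE ζ OF RECORD REACHES ONLY THE PLATEAU**: `ζ_□̃♭(b) ≠ 0` and `z` on the gradient stencil of `b` ⟹ `χ_□(z) = 1` (`□̃ ⊂ NearC 2S_j`, one lattice step,
`χ_□ = 1` on `NearC 3S_j`). [cite: Balaban1985BackgroundPropagators, (3.105) p.414 («ζ_□̃ ∈ C₀^∞(□̃)»), p.408, (3.3) p.390; Balaban1984PropagatorsII, p.239, (2.2) p.224] -/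
theorem chiY_eq_one_of_zetaY_gradK {bnd : FBondY i} {z : SiteY i} (hf : hBdY i (zetaY i c) bnd ≠ 0) (hz : gradK i bnd z ≠ 0) :
    chiY i c z = 1 := by
  have hS := one_le_SC i c
  have hsrc : NearC i c (2 * SC i c) (chartY i bnd.src).1 := nearC_of_mem_QbigT i c (mem_of_zetaY_ne_zero i c hf) rfl
  rcases gradK_ne_zero_imp i hz with h1 | h1
  · rw [h1]; exact chiY_eq_one_of_nearC i c (by linarith) hsrc
  · rw [h1, chart_tgt_eq_shiftY]
    exact chiY_eq_one_of_nearC i c (by linarith) (nearC_shiftY i c hsrc bnd.dir)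

/-- ★ **`h_□` REACHES ONLY THE PLATEAU**: `h_□♭(b) ≠ 0` and `z` on the gradient stencil of `b` ⟹ `χ_□(z) = 1` (`supp h_□ ⊂ NearC S_j`).
[cite: Balaban1985BackgroundPropagators, (3.87) p.409, p.408, (3.8) p.392; Balaban1984PropagatorsII, (2.36) p.229, (2.2) p.224] -/
theorem chiY_eq_one_of_hTY_gradK {bnd : FBondY i} {z : SiteY i} (hf : hBdY i (hTY i c) bnd ≠ 0) (hz : gradK i bnd z ≠ 0) :
    chiY i c z = 1 := by
  have hS := one_le_SC i c
  have hsrc : NearC i c (SC i c) (chartY i bnd.src).1 := nearC_of_hT_ne_zero i c hf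
  rcases gradK_ne_zero_imp i hz with h1 | h1
  · rw [h1]; exact chiY_eq_one_of_nearC i c (by linarith) hsrc
  · rw [h1, chart_tgt_eq_shiftY]
    exact chiY_eq_one_of_nearC i c (by linarith) (nearC_shiftY i c hsrc bnd.dir)

end Plateau

/-! ## §3  The member (3.49)₄ word for two end letters given by their (3.42)₁∕₃ entries -/

section Word

variable [Fintype (geo9K i).Site] [DecidableEq (geo9K i).Site] {Rr : ℝ} {Hp : Prop}
variable (parS : SiteParY 𝔸 i) (Gp : SiteOpY 𝔸 i)

set_option maxHeartbeats 3200000 in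
/-- ★★★ **(3.49)₄ ON THE MEMBER's BOND CARRIER FOR A WORD `D_U·E_L·Q′*X⁻¹Q′(U)·E_R·D*_U` WITH TWO END LETTERS GIVEN BY ENTRIES**: from the entry-1 majorants
`∀ μ, conj b(∇_μ(U))·conj b(η²E_L) ≺ B_L·ℓ(a)·e^{−δd}` (rows of `E_L`), the entry-2 majorants `∀ ν, conj b(η²E_R)·conj b(∇*_ν(U)) ≺ B_R·ℓ(a)·e^{−δd}`, bi-contractive
`parS U`, `η = |c_f|⁻¹`, a (3.48) block majorant of `conj b(s·X⁻¹(U))` (`η⁴s = 1`) at the same rate, (2.61) at `(δ₀, β)`, the transfers of `ℓ, ℓ⁻⁴` at `(δ₀, α, Λ)`,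
`ρ + (2α+β)δ₀ ≤ δ`:  `conj b((D_U·(E_L·(Q′*X⁻¹Q′)(U)·E_R)·D*_U)^ℝ) ≺ (M₂Σ‖b_j‖)²·B_L·B₁·((d+1)B_R)·Λ⁴·c₁(δ₀,β)² · ℓ(a)⁻² · e^{−ρ·d(a,y)}` over
`(toB6 (geo9K i) Rr Hp, ιB∘blkV1)` — r06's `hasMajorantHom_word349₂` at the member carriers (Z2-P §2's road with generic end letters), the word identity, p38's relabel.
[cite: Balaban1985BackgroundPropagators, (3.49) p.399, (3.25) p.394, Thm 3.1 (3.42) p.397, Thm 3.2 (3.48) p.398, (3.21), (3.24) p.394; Balaban1984PropagatorsII, (2.51)–(2.55) p.232, Lemma 2.1 (2.60)–(2.61) p.234, (2.46) p.231] -/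
theorem hasMajorant_conj_gradWdiv_of_entries (ιB : BlkY i → IBondY i) (U : CfgY 𝔸 i) (EL ER : (SiteY i → 𝔸) →ₗ[ℂ] (SiteY i → 𝔸))
    (hpar : ∀ z w : SiteY i, ‖(parS U z w : 𝔸)‖ ≤ 1 ∧ ‖(((parS U z w)⁻¹ : 𝔸ˣ) : 𝔸)‖ ≤ 1)
    {M₂ : ℝ} (hM₂ : 0 ≤ M₂) (hrepr : ∀ (v : 𝔸) (j : ι), |b.repr v j| ≤ M₂ * ‖v‖) (hη : etaS i = |i.cf|⁻¹)
    {s B₁ BL BR δ : ℝ} (hs : (etaS i ^ 2 * etaS i ^ 2) * s = 1) (hB₁ : 0 ≤ B₁) (hBL : 0 ≤ BL) (hBR : 0 ≤ BR)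
    (hL : ∀ μ : Fin (d + 1), HasMajorant (g := toB6 (geo9K i) Rr Hp) (fun p : SiteY i × ι => ιB (blkOf i.D.toDomains p.1))
      (conj b (diffLetter (shiftY i) (UboxY i U) (((etaS i : ℝ) : ℂ))⁻¹ (Sum.inl μ)) * conj b ((etaS i ^ 2) • EL.restrictScalars ℝ))
      (fun a a' => BL * (geo9K i).len a * Real.exp (-(δ * (geo9K i).dist a a'))))
    (hR : ∀ ν : Fin (d + 1), HasMajorant (g := toB6 (geo9K i) Rr Hp) (fun p : SiteY i × ι => ιB (blkOf i.D.toDomains p.1))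
      (conj b ((etaS i ^ 2) • ER.restrictScalars ℝ) * conj b (diffLetter (shiftY i) (UboxY i U) (((etaS i : ℝ) : ℂ))⁻¹ (Sum.inr ν)))
      (fun a a' => BR * (geo9K i).len a * Real.exp (-(δ * (geo9K i).dist a a'))))
    (hCinv : HasMajorant (g := toB6 (geo9K i) Rr Hp) (fun q : BlkY i × ι => ιB q.1) (conj b (s • (XinvY i parS Gp U).restrictScalars ℝ))
      (fun a a' => B₁ * ((geo9K i).len a ^ 4)⁻¹ * Real.exp (-(δ * (geo9K i).dist a a'))))
    (dB : ℕ) {δ₀ α β' ρ Λ : ℝ} (hΛ : 1 ≤ Λ) (hρ : 0 ≤ ρ) (hα : 0 ≤ α) (hβ : 0 ≤ β') (hδ₀ : 0 ≤ δ₀)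
    (hr : ρ + (2 * α + β') * δ₀ ≤ δ)
    (h261 : Ineq261 dB (toB6 (geo9K i) Rr Hp) δ₀ β')
    (hT1 : ScaleTransfer (geo9K i) δ₀ α Λ (fun a => (geo9K i).len a))
    (hT4 : ScaleTransfer (geo9K i) δ₀ α Λ (fun a => ((geo9K i).len a ^ 4)⁻¹)) :
    HasMajorant (g := toB6 (geo9K i) Rr Hp) (fun p : FBondY i × ι => ιB (blkV1 i.hN i.D p.1))
      (conj b ((gradY i U ∘ₗ (EL ∘ₗ (QpsY i parS U ∘ₗ XinvY i parS Gp U ∘ₗ QpY i parS U) ∘ₗ ER) ∘ₗ divY i U).restrictScalars ℝ))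
      (fun a y => ((M₂ * ∑ j, ‖b j‖) * (M₂ * ∑ j, ‖b j‖) * BL * B₁ * (((d : ℝ) + 1) * BR) * Λ ^ 4 * B6.c1 dB δ₀ β' ^ 2) *
        ((geo9K i).len a ^ 2)⁻¹ * Real.exp (-(ρ * (geo9K i).dist a y))) := by
  obtain ⟨htri, -, hdnn⟩ := geo9K_axioms i Rr Hp
  have hlen : ∀ y : (geo9K i).Site, 0 < (geo9K i).len y := B6KLevelCensusIndexV1.len_pos i
  have hSb : 0 ≤ ∑ j, ‖b j‖ := Finset.sum_nonneg fun _ _ => norm_nonneg _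
  have hκQ : 0 ≤ M₂ * ∑ j, ‖b j‖ := mul_nonneg hM₂ hSb
  have hd1 : (0 : ℝ) ≤ (d : ℝ) + 1 := by positivity
  have hBR' : 0 ≤ ((d : ℝ) + 1) * BR := mul_nonneg hd1 hBR
  -- the dressed end letters between the site and the bond coordinates
  have hDG : HasMajorantHom (g := toB6 (geo9K i) Rr Hp) (fun p : SiteY i × ι => ιB (blkOf i.D.toDomains p.1))
      (fun q : (Fin (d + 1) × SiteY i) × ι => ιB (blkOf i.D.toDomains q.1.2))
      (conjHom b (gradLin (shiftY i) (((etaS i : ℝ) : ℂ))⁻¹ (UboxY i U)) ∘ₗ conj b ((etaS i ^ 2) • EL.restrictScalars ℝ))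
      (fun a a' => BL * (geo9K i).len a * Real.exp (-(δ * (geo9K i).dist a a'))) :=
    hasMajorantHom_gradLin (g := geo9K i) (R := Rr) (H := Hp) b (shiftY i) (UboxY i U) (fun z : SiteY i => ιB (blkOf i.D.toDomains z))
      (((etaS i : ℝ) : ℂ))⁻¹ hL
  have hGDs : HasMajorantHom (g := toB6 (geo9K i) Rr Hp) (fun q : (Fin (d + 1) × SiteY i) × ι => ιB (blkOf i.D.toDomains q.1.2))
      (fun p : SiteY i × ι => ιB (blkOf i.D.toDomains p.1))
      (conj b ((etaS i ^ 2) • ER.restrictScalars ℝ) ∘ₗ conjHom b (divLin (shiftY i) (((etaS i : ℝ) : ℂ))⁻¹ (UboxY i U)))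
      (fun a a' => ((d : ℝ) + 1) * BR * (geo9K i).len a * Real.exp (-(δ * (geo9K i).dist a a'))) := by
    refine hasMajorantHom_mono (g := toB6 (geo9K i) Rr Hp) _ _
      (hasMajorantHom_divLin (g := geo9K i) (R := Rr) (H := Hp) b (shiftY i) (UboxY i U) (fun z : SiteY i => ιB (blkOf i.D.toDomains z))
        (((etaS i : ℝ) : ℂ))⁻¹ hR) fun a a' => le_of_eq ?_
    have hcard : (Fintype.card (Fin (d + 1)) : ℝ) = (d : ℝ) + 1 := by rw [Fintype.card_fin]; push_cast; ring
    rw [hcard]; ring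
  -- r06's engine at the member carriers
  have h4 := hasMajorantHom_word349₂ (R := Rr) (H := Hp)
    (fun q : (Fin (d + 1) × SiteY i) × ι => ιB (blkOf i.D.toDomains q.1.2)) (fun q : (Fin (d + 1) × SiteY i) × ι => ιB (blkOf i.D.toDomains q.1.2))
    (fun p : SiteY i × ι => ιB (blkOf i.D.toDomains p.1)) (fun q : BlkY i × ι => ιB q.1) dB δ₀ δ α β' ρ Λ
    (M₂ * ∑ j, ‖b j‖) (M₂ * ∑ j, ‖b j‖) BL B₁ (((d : ℝ) + 1) * BR) (fun a => (geo9K i).len a) (fun a => (geo9K i).len a)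
    (fun a => (hlen a).le) (fun a => (hlen a).le) hκQ hκQ hBL hB₁ hBR' hΛ hρ hα hβ hδ₀ hr hdnn htri h261 hT1 hT4
    hDG hGDs (hasMajorantHom_conjHom_QpY i b ιB parS U hpar hM₂ hrepr) (hasMajorantHom_conjHom_QpsY i b ιB parS U hpar hM₂ hrepr) hCinv
  -- the word IS `D ∘ conj b((E_L·S·E_R)^ℝ) ∘ D*`; the derivative unit IS `|c_f|`; relabel to def-Y's bond carrier
  obtain ⟨hηC, hsq⟩ := inv_etaS_coe_eq i hη
  rw [word_eq_conj₂ i b parS _ _ U EL ER (XinvY i parS Gp U) hs, hηC] at h4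
  have h4' := (hasMajorantHom_iff (g := toB6 (geo9K i) Rr Hp) _ _ _).1 h4
  refine hasMajorant_mono (g := toB6 (geo9K i) Rr Hp) _
    (hasMajorant_conj_gradMdiv_of_relabel b i (g := geo9K i) (Rr := Rr) (H := Hp) (fun z : SiteY i => ιB (blkOf i.D.toDomains z)) _ _ hsq h4')
    fun a y => le_of_eq ?_
  have hl : (geo9K i).len a ≠ 0 := (hlen a).ne'
  field_simp

end Word

end Literature.MathematicalPhysics.QuantumFieldTheory.Balaban1983to89.B9Eq3105FamThreeCore

end
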